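import Literature.MathematicalPhysics.QuantumFieldTheory.Balaban1983to89.B8Eq188Proof
import Literature.MathematicalPhysics.QuantumFieldTheory.Balaban1983to89.B8Eq178Averages

/-!
# `Balaban1983to89.B8Eq190System` — T. Bałaban, *Spaces of regular gauge field configurations on a lattice and gauge
# fixing conditions*, Commun. Math. Phys. **99** (1985) 75–102 [Balaban1985RegularSpaces], (1.90) p. 91: the system
# «Rg(i ad_λ)D\*Dλ + Re^{−i ad_λ}D\*A + R𝔉₃(λ, Dλ, A) = 0, Q′(u₁, λ) = 0» DERIVED from (1.79), (1.80) and (1.88) on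
# the `ℤᵈ` carriers of `B8Eq188Proof` (row **B8.Eq1.90**)

statement-level skeleton of published theorems with citation tags; proofs where landed; nothing here is a claim about the Yang–Mills mass gap

PDF held: `paper:balaban1985-cmp99-regular-spaces-gauge-fixing` (journal page = PDF page + 74).  Pages read for this module
AS IMAGES: renders `run/shared/lean/pub/pub-balaban/b2b-balaban-ref1/pages/1985-cmp99-regular-spaces-gauge-fixing/…-p016-x2.png`
(p. 90) and `…-p017-x2.png` (p. 91), this session.

CITATION HEADER (lean-in-tree rule).  Cell `lit-balaban`, unit `lit-balaban-r05` gen 15 (B8 fold owner); SKELETON row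
**B8.Eq1.90** ((1.90) p. 91, head «typed-existing» before this module: the abstract fixed-point packaging
`B8SectDSource.propFive_fixedPoint` only NAMES the system).  THIS MODULE DERIVES the display (1.90) from the displays it is
printed to follow from — (1.79)/(1.80) p. 90 and (1.88) p. 91 — on the concrete `ℤᵈ` carriers of the lineage files
`B8Eq182Proof`/`B8Eq184Proof`/`B8Eq188Proof` (p05 gen 2; (1.88) = `B8Eq188Proof.eq188`, consumed BY NAME) and
`B8Eq178Averages` (r05 gen 5; (1.79) = `Cond179`, consumed BY NAME).  Kind: definitions WITH BODIES for the four displayed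
site functions of (1.80)/(1.90) and the system (1.90) as a predicate, + theorems; no `… : Prop` fact without proof is
introduced; 0 sorry.

WHAT IS PRINTED (verbatim).
* p. 90 [PDF 16]: *"… and we may write these conditions for u′u₁ in the following way ũ′ʲ = … = 1 on Λ_j, j = 0, 1, …, k,
  (1.78) or equivalently as Q′(u₁, λ) = 0 on 𝔅_k, λ = (1/i) log u′, (1.79) where Q′(u₁, λ, y) = Q′_j(u₁, λ, y) for
  y ∈ Λ_j ⊂ 𝔅_k.  We get a second equation for λ using (1.38): RD\*(1/iη) log U₁^{u′⁻¹} = 0. (1.80)"*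
* p. 91 [PDF 17]: *"and (D\*(1/iη) log U₁^{u′⁻¹})(x) = e^{−i ad_{λ(x)}}(D\*A)(x) + g(i ad_{λ(x)})(D\*Dλ)(x) + 𝔉₃(λ(x), Dλ, A),
  (1.88) where 𝔉₃ depends on (Dλ)(b), A_b for b ∈ st(x) and satisfies |𝔉₃(λ(x), Dλ, A)| ≦ O(1)|Dλ||A|. (1.89)
  Equations (1.79), (1.80) can be written as  Rg(i ad_λ)D\*Dλ + Re^{−i ad_λ}D\*A + R𝔉₃(λ, Dλ, A) = 0,  Q′(u₁, λ) = 0. (1.90)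
  The function Q′(u₁, λ) is almost equal to Q′λ, the linear averaging operator used in the definition of the operator R, …"*
* p. 80 [PDF 6], (1.27): R(U₀) = the orthogonal projection in the real Hilbert space L²(Ω₀, 𝔤) onto Δ^η_{U₀}N(Q′(U₀)) — an
  ℝ-LINEAR operator on 𝔤-valued site functions; p. 90, (1.77): *"|λ| < α₄, |(Dλ)(b)| < α₄(Lʲη)⁻¹ for b ∈ Ω_j,
  j = 0, 1, …, k − 1, (1.77) where α₄ is sufficiently small"*; p. 88, (1.69): *"|A| < B₁(α₀ + α₁)(Lʲη)⁻¹ … on Ω_j"*.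

DICTIONARY print ↦ Lean (conventions of `B8Eq188Proof`, READING (R1) there: `D\*` on a bond field is `Σ_μ D\*_μ`).  Sites
`Site d = ℤᵈ`, spacing the explicit real `η > 0`, bond `⟨x, x + ηe_μ⟩ ↦ (x, μ)`; `λ ↦ lam`, `u′ = e^{iλ} ↦ B8Eq184Proof.gaugeExp lam`;
`(D\*(1/iη) log U₁^{u′⁻¹})(x)` ↦ **`divLog η U₀ lam A x`** (= `Σ_μ covDeriv η U₀ μ (logCfg η U₀ lam A · μ) x`);
`g(i ad_{λ(x)})(D\*Dλ)(x)` ↦ **`termG η U₀ lam x`**; `e^{−i ad_{λ(x)}}(D\*A)(x)` ↦ **`termE η U₀ lam A x`**; `𝔉₃(λ(x), Dλ, A)` ↦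
**`termF η U₀ lam A x`** (= `Σ_μ B8Eq188Proof.frakF3 … x μ`, p05's explicit remainder); the operator `R` ↦ ANY additive map
`R : (Site d → 𝔸) →+ W` (print's R(U₀) of (1.27) is ℝ-linear, hence additive — the rewriting uses nothing else);
(1.80) ↦ `R (divLog η U₀ lam A) = 0`; the first line of (1.90) ↦ `R (termG …) + R (termE …) + R (termF …) = 0`;
(1.79) ↦ `B8Eq178Averages.Cond179 L k Λ U₀ (gaugeExp lam) u₁` (print's `λ = (1/i) log u′`: `(1/i) log e^{iλ} = λ`);
the system (1.90) ↦ **`Sys190 R L k Λ η U₀ lam A u₁`**.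

WHAT THIS MODULE PROVES (kernel-checked, 0 sorry).  §1 `divLog_apply_eq` — (1.88) as the pointwise identity
`divLog = termE + termG + termF` at a site where p05's bond-local smallness holds (`eq188` by name), `divLog_eq` — as an
identity of site functions; §2 **`map_divLog_eq`** — for EVERY additive `R`: `R(D\*(1/iη) log U₁^{u′⁻¹}) = Rg(i ad_λ)D\*Dλ +
Re^{−i ad_λ}D\*A + R𝔉₃` (print's order), hence **`cond180_iff_eq190`**: (1.80) ⟺ the first line of (1.90), and
**`sys190_iff`**: «(1.79) ∧ (1.80)» ⟺ (1.90) — the printed sentence "Equations (1.79), (1.80) can be written as (1.90)";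
§3 the Ω-LOCAL form (`map_divLog_eq_of_eqOn`, `cond180_iff_eq190_local`): if `R` only reads the sites of a set `S`
(`∀ f g, EqOn f g S → R f = R g` — R(U₀) lives on L²(Ω₀, 𝔤)) the smallness is needed on `S` only; §4 the smallness in the
PRINTED variables (`small_of_printed`: `|λ(x)| ≦ 1/12`, `η|(Dλ)(b)| ≦ 1/70`, `η|A_b| ≦ 1/12` at the bonds of `st(x)`, `U₀`
with values in the norm-one group `U1 ⊇ U(N)`) and its provenance from the standing hypotheses (1.77)/(1.69)
(`eta_mul_le_of_scaled`: a bound `|X_b| < c(Lʲη)⁻¹` on a level-`j` bond gives `η|X_b| < cL⁻ʲ ≦ c`, so (1.77) with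
`α₄ ≦ 1/70` and (1.69) with `B₁(α₀ + α₁) ≦ 1/12` suffice wherever the bonds of `st(x)` lie in some `Ω_j`;
`cond180_iff_eq190_printed`).

HONEST SCOPE.  (i) This is the REWRITING step only: (1.88) is p05's theorem, (1.79) ⟺ (1.78) is `B8Eq178Averages`, and
nothing is said here about SOLVING (1.90) (Sects. D–E: `B8SectDSource`, `B8SectEStatements`, `B8Eq191Hprime`, …).  (ii) `R` is
kept abstract (any additive map): the tree's concrete Landau projection lives on the `B9Thm311Lattice` carriers
(`B8Eq127LandauGauge.Landau138L`), not on these `ℤᵈ` carriers (INTERFACES-B8 I-B8-1, second half) — the rewriting is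
insensitive to which additive `R` is meant.  (iii) `𝔉₃` is p05's EXPLICIT remainder (print leaves it unnamed); its bound
(1.89) is `B8Eq188Proof.norm_frakF3_le` (with the located second-order caveat G-B8-11(b) of the audit cell), not restated.
(iv) The smallness thresholds `1/12`, `1/70` are those of `B8Eq188Proof.eq188` ("α₄ sufficiently small", p. 90).
-/

noncomputable section

open Set

namespace Literature.MathematicalPhysics.QuantumFieldTheory.Balaban1983to89.B8Eq190System

open B8Eq182Proof (gAd)
open B8Eq184Proof (gaugeExp)
open B8Eq188Proof (logCfg frakF3 eq188)
open B8Eq178Averages (Cond179)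
open B7Prop1Explicit (e U1)
open B7Eq78Linearization (conjR)
open B8Ineq132 (covDerivFwd covDeriv norm_conjR BondTouches)
open B8Eq151V2Divergence (norm_covDeriv_eq)

-- `Site` alone would resolve to the torus sites of `Setup.lean`; re-export the `ℤ^d` sites of `B7Prop1Explicit`
-- (as `B8Eq178Averages`/`B8Eq188Proof` do).
export B7Prop1Explicit (Site)

variable {d : ℕ} {𝔸 : Type*} [NormedRing 𝔸] [NormedAlgebra ℂ 𝔸] [NormOneClass 𝔸] [CompleteSpace 𝔸]

/-! ## §0 The four displayed site functions and the system (1.90) -/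

/-- **`(D*(1/iη) log U₁^{u′⁻¹})(x)`** — the site function under `R` in (1.80) and on the left of (1.88): the covariant
divergence `Σ_μ D*_μ` (READING (R1) of `B8Eq188Proof`) of the bond field `(1/iη) log (U₁^{u′⁻¹})_b` (`B8Eq188Proof.logCfg`).
[cite: Balaban1985RegularSpaces, (1.80) p.90, (1.88) p.91] -/
def divLog (η : ℝ) (U₀ : Site d → Fin d → 𝔸ˣ) (lam : Site d → 𝔸) (A : Site d → Fin d → 𝔸) (x : Site d) : 𝔸 :=
  ∑ μ, covDeriv η U₀ μ (fun y => logCfg η U₀ lam A y μ) x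

/-- **`g(i ad_{λ(x)})(D*Dλ)(x)`** — the first term of (1.90) before `R` (`g(i ad_Y)X = B8Eq182Proof.gAd X Y`, [3] (32);
`(D*Dλ)(x) = Σ_μ (D*_μD_μλ)(x)`). [cite: Balaban1985RegularSpaces, (1.88) p.91, (1.90) p.91] -/
def termG (η : ℝ) (U₀ : Site d → Fin d → 𝔸ˣ) (lam : Site d → 𝔸) (x : Site d) : 𝔸 :=
  gAd (∑ μ, covDeriv η U₀ μ (covDerivFwd η U₀ μ lam) x) (lam x)

/-- **`e^{−i ad_{λ(x)}}(D*A)(x)`** — the second term of (1.90) before `R` (`e^{−i ad_{λ(x)}}X = R(u′(x)⁻¹)X`, `u′ = e^{iλ}`).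
[cite: Balaban1985RegularSpaces, (1.88) p.91, (1.90) p.91] -/
def termE (η : ℝ) (U₀ : Site d → Fin d → 𝔸ˣ) (lam : Site d → 𝔸) (A : Site d → Fin d → 𝔸) (x : Site d) : 𝔸 :=
  conjR (gaugeExp lam x)⁻¹ (∑ μ, covDeriv η U₀ μ (fun y => A y μ) x)

/-- **`𝔉₃(λ(x), Dλ, A)`** — the third term of (1.90) before `R`: p05's EXPLICIT remainder of (1.88) summed over the directions
(`Σ_μ B8Eq188Proof.frakF3 … x μ`; print leaves `𝔉₃` unnamed). [cite: Balaban1985RegularSpaces, (1.88)–(1.89) p.91, (1.90) p.91] -/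
def termF (η : ℝ) (U₀ : Site d → Fin d → 𝔸ˣ) (lam : Site d → 𝔸) (A : Site d → Fin d → 𝔸) (x : Site d) : 𝔸 :=
  ∑ μ, frakF3 η U₀ lam A x μ

/-- **THE SYSTEM (1.90)**, verbatim: *"Rg(i ad_λ)D*Dλ + Re^{−i ad_λ}D*A + R𝔉₃(λ, Dλ, A) = 0, Q′(u₁, λ) = 0. (1.90)"* — for an
additive operator `R` on site functions (print: the Landau projection R(U₀) of (1.27)), the second line being (1.79)
«`Q′(u₁, λ) = 0` on `𝔅_k`» in its typed form `B8Eq178Averages.Cond179` for `u′ = e^{iλ}` (`gaugeExp lam`).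
[cite: Balaban1985RegularSpaces, (1.90) p.91, (1.79) p.90] -/
def Sys190 {W : Type*} [AddCommMonoid W] (R : (Site d → 𝔸) →+ W) (L k : ℕ) (Λ : ℕ → Set (Site d)) (η : ℝ)
    (U₀ : Site d → Fin d → 𝔸ˣ) (lam : Site d → 𝔸) (A : Site d → Fin d → 𝔸) (u₁ : Site d → 𝔸ˣ) : Prop :=
  R (termG η U₀ lam) + R (termE η U₀ lam A) + R (termF η U₀ lam A) = 0 ∧ Cond179 L k Λ U₀ (gaugeExp lam) u₁

/-- The bond-local smallness under which p05's (1.88) (`B8Eq188Proof.eq188`) holds at the site `x`: `|λ(x)| ≦ 1/12`,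
`η|(D_μλ)(x)| ≦ 1/70`, `η|(D*_μλ)(x)| ≦ 1/70`, `η|R(U₀(x, x − ηe_μ))A_μ(x − ηe_μ)| ≦ 1/12` for every `μ` ("α₄ sufficiently small",
p. 90; instances of (1.77) and (1.69), §4). [cite: Balaban1985RegularSpaces, (1.77) p.90, (1.69) p.88, (1.88) p.91] -/
def SmallAt (η : ℝ) (U₀ : Site d → Fin d → 𝔸ˣ) (lam : Site d → 𝔸) (A : Site d → Fin d → 𝔸) (x : Site d) : Prop :=
  ‖lam x‖ ≤ 1 / 12 ∧ (∀ μ, η * ‖covDerivFwd η U₀ μ lam x‖ ≤ 1 / 70) ∧ (∀ μ, η * ‖covDeriv η U₀ μ lam x‖ ≤ 1 / 70) ∧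
    ∀ μ, η * ‖conjR (U₀ (x - e μ) μ)⁻¹ (A (x - e μ) μ)‖ ≤ 1 / 12

/-! ## §1 (1.88) as an identity of site functions -/

/-- **(1.88) at a site**, in the vocabulary of (1.90): `(D*(1/iη) log U₁^{u′⁻¹})(x) = e^{−i ad_{λ(x)}}(D*A)(x) +
g(i ad_{λ(x)})(D*Dλ)(x) + 𝔉₃(λ(x), Dλ, A)` — p05's `B8Eq188Proof.eq188` BY NAME. [cite: Balaban1985RegularSpaces, (1.88) p.91] -/
theorem divLog_apply_eq {η : ℝ} (hη : 0 < η) (U₀ : Site d → Fin d → 𝔸ˣ) {lam : Site d → 𝔸} (A : Site d → Fin d → 𝔸)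
    {x : Site d} (hx : SmallAt η U₀ lam A x) :
    divLog η U₀ lam A x = termE η U₀ lam A x + termG η U₀ lam x + termF η U₀ lam A x :=
  eq188 hη U₀ A hx.1 hx.2.1 hx.2.2.1 hx.2.2.2

/-- **(1.88) as an identity of site FUNCTIONS** (smallness at every site). [cite: Balaban1985RegularSpaces, (1.88) p.91] -/
theorem divLog_eq {η : ℝ} (hη : 0 < η) (U₀ : Site d → Fin d → 𝔸ˣ) {lam : Site d → 𝔸} (A : Site d → Fin d → 𝔸)
    (h : ∀ x, SmallAt η U₀ lam A x) :
    divLog η U₀ lam A = termE η U₀ lam A + termG η U₀ lam + termF η U₀ lam A :=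
  funext fun x => by simpa only [Pi.add_apply] using divLog_apply_eq hη U₀ A (h x)

/-- (1.88) restricted to a set of sites `S` (smallness on `S` only): the two sides AGREE ON `S`.
[cite: Balaban1985RegularSpaces, (1.88) p.91] -/
theorem divLog_eqOn {η : ℝ} (hη : 0 < η) (U₀ : Site d → Fin d → 𝔸ˣ) {lam : Site d → 𝔸} (A : Site d → Fin d → 𝔸)
    {S : Set (Site d)} (h : ∀ x ∈ S, SmallAt η U₀ lam A x) :
    EqOn (divLog η U₀ lam A) (termE η U₀ lam A + termG η U₀ lam + termF η U₀ lam A) S :=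
  fun x hx => by simpa only [Pi.add_apply] using divLog_apply_eq hη U₀ A (h x hx)

/-! ## §2 «Equations (1.79), (1.80) can be written as (1.90)» — for every additive `R` -/

section Global

variable {W : Type*} [AddCommMonoid W]

/-- **`R` applied to (1.88)**: for EVERY additive operator `R` on site functions,
`R(D*(1/iη) log U₁^{u′⁻¹}) = Rg(i ad_λ)D*Dλ + Re^{−i ad_λ}D*A + R𝔉₃(λ, Dλ, A)` (print's order of the terms).
[cite: Balaban1985RegularSpaces, (1.88) p.91, (1.90) p.91] -/
theorem map_divLog_eq (R : (Site d → 𝔸) →+ W) {η : ℝ} (hη : 0 < η) (U₀ : Site d → Fin d → 𝔸ˣ) {lam : Site d → 𝔸}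
    (A : Site d → Fin d → 𝔸) (h : ∀ x, SmallAt η U₀ lam A x) :
    R (divLog η U₀ lam A) = R (termG η U₀ lam) + R (termE η U₀ lam A) + R (termF η U₀ lam A) := by
  rw [divLog_eq hη U₀ A h, map_add, map_add, add_comm (R (termE η U₀ lam A))]

/-- **(1.80) ⟺ the first line of (1.90)**: `RD*(1/iη) log U₁^{u′⁻¹} = 0` iff `Rg(i ad_λ)D*Dλ + Re^{−i ad_λ}D*A + R𝔉₃ = 0`,
for every additive `R`. [cite: Balaban1985RegularSpaces, (1.80) p.90, (1.90) p.91] -/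
theorem cond180_iff_eq190 (R : (Site d → 𝔸) →+ W) {η : ℝ} (hη : 0 < η) (U₀ : Site d → Fin d → 𝔸ˣ) {lam : Site d → 𝔸}
    (A : Site d → Fin d → 𝔸) (h : ∀ x, SmallAt η U₀ lam A x) :
    R (divLog η U₀ lam A) = 0 ↔ R (termG η U₀ lam) + R (termE η U₀ lam A) + R (termF η U₀ lam A) = 0 := by
  rw [map_divLog_eq R hη U₀ A h]

/-- **THE PRINTED SENTENCE «Equations (1.79), (1.80) can be written as (1.90)»**: the pair «(1.79) `Q′(u₁, λ) = 0` on `𝔅_k`»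
∧ «(1.80) `RD*(1/iη) log U₁^{u′⁻¹} = 0`» is EQUIVALENT to the system (1.90) (`Sys190`), for every additive `R`, every geometric
datum `(L, k, Λ)` of (1.79) and every auxiliary `u₁`, under the sitewise smallness of p05's (1.88).
[cite: Balaban1985RegularSpaces, (1.90) p.91, (1.79)–(1.80) p.90] -/
theorem sys190_iff (R : (Site d → 𝔸) →+ W) (L k : ℕ) (Λ : ℕ → Set (Site d)) {η : ℝ} (hη : 0 < η)
    (U₀ : Site d → Fin d → 𝔸ˣ) {lam : Site d → 𝔸} (A : Site d → Fin d → 𝔸) (u₁ : Site d → 𝔸ˣ)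
    (h : ∀ x, SmallAt η U₀ lam A x) :
    (Cond179 L k Λ U₀ (gaugeExp lam) u₁ ∧ R (divLog η U₀ lam A) = 0) ↔ Sys190 R L k Λ η U₀ lam A u₁ := by
  rw [Sys190, cond180_iff_eq190 R hη U₀ A h, and_comm]

/-- (1.79) ∧ (1.80) ⟹ (1.90). [cite: Balaban1985RegularSpaces, (1.90) p.91] -/
theorem sys190_of_179_180 (R : (Site d → 𝔸) →+ W) (L k : ℕ) (Λ : ℕ → Set (Site d)) {η : ℝ} (hη : 0 < η)
    (U₀ : Site d → Fin d → 𝔸ˣ) {lam : Site d → 𝔸} (A : Site d → Fin d → 𝔸) (u₁ : Site d → 𝔸ˣ)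
    (h : ∀ x, SmallAt η U₀ lam A x) (h179 : Cond179 L k Λ U₀ (gaugeExp lam) u₁) (h180 : R (divLog η U₀ lam A) = 0) :
    Sys190 R L k Λ η U₀ lam A u₁ :=
  (sys190_iff R L k Λ hη U₀ A u₁ h).mp ⟨h179, h180⟩

/-- (1.90) ⟹ (1.79) ∧ (1.80). [cite: Balaban1985RegularSpaces, (1.90) p.91] -/
theorem cond179_180_of_sys190 (R : (Site d → 𝔸) →+ W) (L k : ℕ) (Λ : ℕ → Set (Site d)) {η : ℝ} (hη : 0 < η)
    (U₀ : Site d → Fin d → 𝔸ˣ) {lam : Site d → 𝔸} (A : Site d → Fin d → 𝔸) (u₁ : Site d → 𝔸ˣ)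
    (h : ∀ x, SmallAt η U₀ lam A x) (h190 : Sys190 R L k Λ η U₀ lam A u₁) :
    Cond179 L k Λ U₀ (gaugeExp lam) u₁ ∧ R (divLog η U₀ lam A) = 0 :=
  (sys190_iff R L k Λ hη U₀ A u₁ h).mpr h190

end Global

/-! ## §3 The Ω-local form: `R` reads only the sites of a set `S` (R(U₀) acts on L²(Ω₀, 𝔤)) -/

section Local

variable {W : Type*} [AddCommMonoid W]

/-- **`R` applied to (1.88), LOCAL form**: if `R` depends only on the values on `S` (`R f = R g` whenever `f = g` on `S`)
and the smallness holds on `S`, then `R(D*(1/iη) log U₁^{u′⁻¹}) = Rg(i ad_λ)D*Dλ + Re^{−i ad_λ}D*A + R𝔉₃`.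
[cite: Balaban1985RegularSpaces, (1.88) p.91, (1.90) p.91, (1.27) p.80] -/
theorem map_divLog_eq_of_eqOn (R : (Site d → 𝔸) →+ W) {S : Set (Site d)}
    (hR : ∀ f g : Site d → 𝔸, EqOn f g S → R f = R g) {η : ℝ} (hη : 0 < η) (U₀ : Site d → Fin d → 𝔸ˣ)
    {lam : Site d → 𝔸} (A : Site d → Fin d → 𝔸) (h : ∀ x ∈ S, SmallAt η U₀ lam A x) :
    R (divLog η U₀ lam A) = R (termG η U₀ lam) + R (termE η U₀ lam A) + R (termF η U₀ lam A) := by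
  rw [hR _ _ (divLog_eqOn hη U₀ A h), map_add, map_add, add_comm (R (termE η U₀ lam A))]

/-- **(1.80) ⟺ the first line of (1.90), LOCAL form** (smallness on the sites `R` reads).
[cite: Balaban1985RegularSpaces, (1.80) p.90, (1.90) p.91] -/
theorem cond180_iff_eq190_local (R : (Site d → 𝔸) →+ W) {S : Set (Site d)}
    (hR : ∀ f g : Site d → 𝔸, EqOn f g S → R f = R g) {η : ℝ} (hη : 0 < η) (U₀ : Site d → Fin d → 𝔸ˣ)
    {lam : Site d → 𝔸} (A : Site d → Fin d → 𝔸) (h : ∀ x ∈ S, SmallAt η U₀ lam A x) :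
    R (divLog η U₀ lam A) = 0 ↔ R (termG η U₀ lam) + R (termE η U₀ lam A) + R (termF η U₀ lam A) = 0 := by
  rw [map_divLog_eq_of_eqOn R hR hη U₀ A h]

/-- **«(1.79), (1.80) can be written as (1.90)», LOCAL form.** [cite: Balaban1985RegularSpaces, (1.90) p.91, (1.79)–(1.80) p.90] -/
theorem sys190_iff_local (R : (Site d → 𝔸) →+ W) {S : Set (Site d)}
    (hR : ∀ f g : Site d → 𝔸, EqOn f g S → R f = R g) (L k : ℕ) (Λ : ℕ → Set (Site d)) {η : ℝ} (hη : 0 < η)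
    (U₀ : Site d → Fin d → 𝔸ˣ) {lam : Site d → 𝔸} (A : Site d → Fin d → 𝔸) (u₁ : Site d → 𝔸ˣ)
    (h : ∀ x ∈ S, SmallAt η U₀ lam A x) :
    (Cond179 L k Λ U₀ (gaugeExp lam) u₁ ∧ R (divLog η U₀ lam A) = 0) ↔ Sys190 R L k Λ η U₀ lam A u₁ := by
  rw [Sys190, cond180_iff_eq190_local R hR hη U₀ A h, and_comm]

end Local

/-! ## §4 The smallness in the printed variables, and its provenance from (1.77)/(1.69) -/

omit [CompleteSpace 𝔸] in
/-- **Smallness in the PRINTED variables** `|λ(x)|`, `|(Dλ)(b)|`, `|A_b|`, `b ∈ st(x)`: for a background with values in the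
norm-one group `U1 ⊇ U(N)` (so that `|(D*_μλ)(x)| = |(Dλ)(⟨x − ηe_μ, x⟩)|` and `|R(U₀(x, x − ηe_μ))A_μ(x − ηe_μ)| = |A_μ(x − ηe_μ)|`),
the conditions `|λ(x)| ≦ 1/12`, `η|(Dλ)(b)| ≦ 1/70` and `η|A_b| ≦ 1/12` at the bonds `b = ⟨x, x + ηe_μ⟩, ⟨x − ηe_μ, x⟩` of `st(x)`
give `SmallAt` at `x`. [cite: Balaban1985RegularSpaces, (1.77) p.90, (1.69) p.88, (1.89) p.91 («b ∈ st(x)»)] -/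
theorem small_of_printed {η : ℝ} {U₀ : Site d → Fin d → 𝔸ˣ} (hU₀ : ∀ x μ, U₀ x μ ∈ U1 𝔸)
    {lam : Site d → 𝔸} {A : Site d → Fin d → 𝔸} {x : Site d} (hl : ‖lam x‖ ≤ 1 / 12)
    (hD : ∀ μ, η * ‖covDerivFwd η U₀ μ lam x‖ ≤ 1 / 70) (hDm : ∀ μ, η * ‖covDerivFwd η U₀ μ lam (x - e μ)‖ ≤ 1 / 70)
    (hAm : ∀ μ, η * ‖A (x - e μ) μ‖ ≤ 1 / 12) : SmallAt η U₀ lam A x := by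
  refine ⟨hl, hD, fun μ => ?_, fun μ => ?_⟩
  · rw [norm_covDeriv_eq (hU₀ (x - e μ) μ) lam]; exact hDm μ
  · rw [norm_conjR ((U1 𝔸).inv_mem (hU₀ (x - e μ) μ))]
    exact hAm μ

/-- **Scale bookkeeping behind "α₄ sufficiently small"**: a level-`j` bound of the printed shape `|X_b| < c·(Lʲη)⁻¹` ((1.77):
`c = α₄` for `X = Dλ`; (1.69): `c = B₁(α₀ + α₁)` for `X = A`) gives `η|X_b| < c·L⁻ʲ ≦ c` for `L ≧ 1`, `η > 0`.
[cite: Balaban1985RegularSpaces, (1.77) p.90, (1.69) p.88] -/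
theorem eta_mul_le_of_scaled {η : ℝ} (hη : 0 < η) {L : ℕ} (hL : 1 ≤ L) (j : ℕ) {c t : ℝ} (hc : 0 ≤ c)
    (ht : t < c * ((L : ℝ) ^ j * η)⁻¹) : η * t < c ∧ η * t ≤ c := by
  have hLj : (1 : ℝ) ≤ (L : ℝ) ^ j := one_le_pow₀ (by exact_mod_cast hL)
  have hLj0 : (0 : ℝ) < (L : ℝ) ^ j := lt_of_lt_of_le one_pos hLj
  have h1 : η * t < η * (c * ((L : ℝ) ^ j * η)⁻¹) := mul_lt_mul_of_pos_left ht hη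
  have h2 : η * (c * ((L : ℝ) ^ j * η)⁻¹) = c / (L : ℝ) ^ j := by
    field_simp
  have h3 : c / (L : ℝ) ^ j ≤ c := div_le_self hc hLj
  exact ⟨by linarith [h1, h2.le, h3], by linarith [h1, h2.le, h3]⟩

omit [CompleteSpace 𝔸] in
/-- **From (1.77) and (1.69) to the smallness of (1.88)/(1.90) at a site `x`**: if `|λ(x)| < α₄ ≦ 1/12`, if the bonds
`⟨x, x + ηe_μ⟩`, `⟨x − ηe_μ, x⟩` of `st(x)` each lie in some `Ω_j` (`B8Ineq132.BondTouches`, p. 77 convention) where (1.77)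
`|(Dλ)(b)| < α₄(Lʲη)⁻¹` with `α₄ ≦ 1/70` and (1.69) `|A_b| < B₁(α₀ + α₁)(Lʲη)⁻¹` with `B₁(α₀ + α₁) ≦ 1/12` hold, and `U₀` is
`U1`-valued, then `SmallAt η U₀ lam A x`. [cite: Balaban1985RegularSpaces, (1.77) p.90, (1.69) p.88, (1.88)–(1.90) p.91] -/
theorem small_of_177_169 {η : ℝ} (hη : 0 < η) {L : ℕ} (hL : 1 ≤ L) {U₀ : Site d → Fin d → 𝔸ˣ}
    (hU₀ : ∀ x μ, U₀ x μ ∈ U1 𝔸) (Ω : ℕ → Set (Site d)) {lam : Site d → 𝔸} {A : Site d → Fin d → 𝔸}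
    {α₄ s : ℝ} (hα₄ : α₄ ≤ 1 / 70) (hs0 : 0 ≤ s) (hs : s ≤ 1 / 12) {x : Site d} (hl : ‖lam x‖ < α₄)
    (h177 : ∀ j (y : Site d) μ, BondTouches (Ω j) y μ → ‖covDerivFwd η U₀ μ lam y‖ < α₄ * ((L : ℝ) ^ j * η)⁻¹)
    (h169 : ∀ j (y : Site d) μ, BondTouches (Ω j) y μ → ‖A y μ‖ < s * ((L : ℝ) ^ j * η)⁻¹)
    (hcov : ∀ μ, (∃ j, BondTouches (Ω j) x μ) ∧ ∃ j, BondTouches (Ω j) (x - e μ) μ) :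
    SmallAt η U₀ lam A x := by
  have hα0 : 0 ≤ α₄ := le_of_lt (lt_of_le_of_lt (norm_nonneg _) hl)
  refine small_of_printed hU₀ (by linarith) (fun μ => ?_) (fun μ => ?_) (fun μ => ?_)
  · obtain ⟨⟨j, hj⟩, -⟩ := hcov μ
    exact ((eta_mul_le_of_scaled hη hL j hα0 (h177 j x μ hj)).2).trans hα₄
  · obtain ⟨-, ⟨j, hj⟩⟩ := hcov μ
    exact ((eta_mul_le_of_scaled hη hL j hα0 (h177 j (x - e μ) μ hj)).2).trans hα₄
  · obtain ⟨-, ⟨j, hj⟩⟩ := hcov μ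
    exact ((eta_mul_le_of_scaled hη hL j hs0 (h169 j (x - e μ) μ hj)).2).trans hs

/-- **(1.80) ⟺ the first line of (1.90) in the printed variables** (global form): `U₀` `U1`-valued, `|λ| ≦ 1/12`,
`η|(Dλ)(b)| ≦ 1/70` and `η|A_b| ≦ 1/12` at every bond — then for every additive `R`,
`RD*(1/iη) log U₁^{u′⁻¹} = 0 ⟺ Rg(i ad_λ)D*Dλ + Re^{−i ad_λ}D*A + R𝔉₃(λ, Dλ, A) = 0`.
[cite: Balaban1985RegularSpaces, (1.80) p.90, (1.90) p.91] -/
theorem cond180_iff_eq190_printed {W : Type*} [AddCommMonoid W] (R : (Site d → 𝔸) →+ W) {η : ℝ} (hη : 0 < η)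
    {U₀ : Site d → Fin d → 𝔸ˣ} (hU₀ : ∀ x μ, U₀ x μ ∈ U1 𝔸) {lam : Site d → 𝔸} (A : Site d → Fin d → 𝔸)
    (hl : ∀ x, ‖lam x‖ ≤ 1 / 12) (hD : ∀ x μ, η * ‖covDerivFwd η U₀ μ lam x‖ ≤ 1 / 70)
    (hA : ∀ x μ, η * ‖A x μ‖ ≤ 1 / 12) :
    R (divLog η U₀ lam A) = 0 ↔ R (termG η U₀ lam) + R (termE η U₀ lam A) + R (termF η U₀ lam A) = 0 :=
  cond180_iff_eq190 R hη U₀ A fun x =>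
    small_of_printed hU₀ (hl x) (fun μ => hD x μ) (fun μ => hD (x - e μ) μ) fun μ => hA (x - e μ) μ

end Literature.MathematicalPhysics.QuantumFieldTheory.Balaban1983to89.B8Eq190System

end
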